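import Summits.QuantumFields.YangMills.Theorems.IR.SCFloorSchwarz
import Literature.MathematicalPhysics.QuantumFieldTheory.YangMillsOS
import Literature.Barriers.QuantumFields.AbelianDeconfinementD4Proofs

/-!
# Strong-coupling floor engine, part 11: `FacingPlaquetteCovFloor` — the volume-uniform `β⁴` law

Pooled prover `ym-ir-line-bsf-p1` (crux `IR`, stmt-QuantumFields-19354; director-ym R366 pooled queue).  THE ENGINE:
for a continuous matrix representation `ρ` of a compact group with `Re tr ρ` non-constant, there are `β₀, c, C > 0`
such that ON EVERY torus `(ℤ/L)⁴`, `L ≥ 3`, and for every `0 < β ≤ β₀`, the connected correlation of the two facing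
plaquette observables at Euclidean time distance `1` satisfies
`c β⁴ ≤ latticeConnectedCorr ρ β L P P 1 ≤ C β⁴`, `P = Re tr ρ(U_{(0;1,2)})` (`facingPlaquetteCorr_floor`), with
`c = φ^{*6}(1)/2`, `C = 3 φ^{*6}(1)/2`, `φ = Re tr ρ − ∫ Re tr ρ`.  This is the first volume-uniform strong-coupling
LOWER bound on a connected correlator in the tree (the census row «tube re-expansion lower bound», instance `n = 1`);
consumers: line `momentum-pincer` rung R2 (`NoLightMoversSCTransfer`: the floor on `s(1)`), line
`ym_ir7_volume_monotone_gap` input `TraceExcessFloorSC`, the `beta-slope-floor` rung census row.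
HONEST: strong coupling only, group-blind; nothing here bears on `BalabanLadder.IR` at weak coupling or on the Clay
Yang–Mills mass gap (R4 closes only the conditional finite-𝕋⁴ rung `BalabanLadder.UV`).
-/

set_option autoImplicit false

noncomputable section

open MeasureTheory Filter Topology Function
open Literature.MathematicalPhysics.QuantumFieldTheory
open Literature.MathematicalPhysics.QuantumLattice (haarConv plaquetteObs torusLift toTorusObservable configShift LGConfig
  plaquetteHolonomyZd)

namespace Summit.QuantumFields.YangMills.Cruxes.IR.SCFloor

variable {G : Type} [Group G] [TopologicalSpace G] [IsTopologicalGroup G] [CompactSpace G] [MeasurableSpace G]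
  [BorelSpace G] [SecondCountableTopology G] [T2Space G] {N : ℕ} (ρ : G →* Matrix (Fin N) (Fin N) ℂ)

omit [SecondCountableTopology G] [T2Space G] in
/-- The tree's connected time-correlation of the plaquette `P = Re tr ρ(U_{(0;1,2)})` with itself at time distance `1`
is the covariance of the two facing plaquette observables of the torus (translation invariance of the Wilson state for
the second mean). -/
theorem latticeConnectedCorr_plaquette_one (L : ℕ) [NeZero L] (β : ℝ) :
    latticeConnectedCorr ρ β L (plaquetteObs ρ 0 1 2) (plaquetteObs ρ 0 1 2) 1 =
      (∫ U, (ρ (plaquetteHolonomy U 0 1 2)).trace.re * (ρ (plaquetteHolonomy U ((0 : Site 4 L).shift 0) 1 2)).trace.re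
          ∂(wilsonMeasure (d := 4) (L := L) ρ β)) -
        (∫ U, (ρ (plaquetteHolonomy U 0 1 2)).trace.re ∂(wilsonMeasure (d := 4) (L := L) ρ β)) *
          ∫ U, (ρ (plaquetteHolonomy U ((0 : Site 4 L).shift 0) 1 2)).trace.re ∂(wilsonMeasure (d := 4) (L := L) ρ β) := by
  have hshift : ∀ W : LGConfig 4 G, plaquetteObs ρ 0 1 2 (configShift (-Pi.single 0 (1 : ℤ)) W) =
      plaquetteObs ρ (Pi.single 0 1) 1 2 W := fun W => by
    rw [Literature.Barriers.QuantumFields.plaquetteObs_configShift]; simp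
  have hp0 : (Literature.Probability.LatticeModels.Torus.proj L (0 : Literature.Probability.LatticeModels.Site 4) :
      Site 4 L) = 0 := by
    funext k; simp [Literature.Probability.LatticeModels.Torus.proj_apply]
  have h0 : ∀ U : GaugeConfig 4 L G, plaquetteObs ρ 0 1 2 (torusLift L U) = (ρ (plaquetteHolonomy U 0 1 2)).trace.re := by
    intro U
    have := congrFun (toTorusObservable_plaquetteObs_eq (L := L) ρ 0 1 2) U
    simp only [toTorusObservable, Function.comp_apply] at this
    rw [this, hp0]
  have hp1 : (Literature.Probability.LatticeModels.Torus.proj L (Pi.single 0 1 : Literature.Probability.LatticeModels.Site 4) :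
      Site 4 L) = (0 : Site 4 L).shift 0 := by
    rw [torusProj_site_single]; simp [Site.shift]
  have h1 : ∀ U : GaugeConfig 4 L G, plaquetteObs ρ (Pi.single 0 1) 1 2 (torusLift L U) =
      (ρ (plaquetteHolonomy U ((0 : Site 4 L).shift 0) 1 2)).trace.re := by
    intro U
    have := congrFun (toTorusObservable_plaquetteObs_eq (L := L) ρ (Pi.single 0 1) 1 2) U
    simp only [toTorusObservable, Function.comp_apply] at this
    rw [this, hp1]
  -- translation invariance for the second mean
  have hmean : ∫ U, (ρ (plaquetteHolonomy U 0 1 2)).trace.re ∂(wilsonMeasure (d := 4) (L := L) ρ β) =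
      ∫ U, (ρ (plaquetteHolonomy U ((0 : Site 4 L).shift 0) 1 2)).trace.re ∂(wilsonMeasure (d := 4) (L := L) ρ β) := by
    have ht : toTorusObservable L (plaquetteObs ρ 0 1 2 ∘ configShift (-Pi.single 0 (1 : ℤ))) =
        fun U : GaugeConfig 4 L G => (ρ (plaquetteHolonomy U ((0 : Site 4 L).shift 0) 1 2)).trace.re := by
      funext U; simp only [toTorusObservable, Function.comp_apply, hshift, h1]
    have hinv := wilsonExpectation_comp_torusConfigShift (L := L) ρ β
      (Literature.Probability.LatticeModels.Torus.proj L
        (-Pi.single (0 : Fin 4) (1 : ℤ) : Literature.Probability.LatticeModels.Site 4))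
      (toTorusObservable L (plaquetteObs ρ 0 1 2))
    rw [← toTorusObservable_comp_configShift, ht] at hinv
    simp only [wilsonExpectation] at hinv
    rw [hinv]
    refine integral_congr_ae (Eventually.of_forall fun U => ?_)
    simp only [toTorusObservable, Function.comp_apply, h0]
  simp only [latticeConnectedCorr, Nat.cast_one, hshift, h0, h1]
  rw [← hmean]

/-- **`FacingPlaquetteCovFloor` — the volume-uniform two-sided `β⁴` law at strong coupling.**  For a continuous
matrix representation `ρ` of a compact group with `Re tr ρ` non-constant there are `β₀, c, C > 0` such that for every
torus `(ℤ/L)⁴` with `L ≥ 3` and every `0 < β ≤ β₀`: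
`c β⁴ ≤ latticeConnectedCorr ρ β L P P 1 ≤ C β⁴`, `P = Re tr ρ(U_{(0;1,2)})`.  Constants: `c = φ^{*6}(1)/2`,
`C = 3φ^{*6}(1)/2`, `φ = Re tr ρ − ∫ Re tr ρ`, `φ^{*6}(1) = ‖φ^{*3}‖² > 0` (parts 1–2). -/
theorem facingPlaquetteCorr_floor (hρ : Continuous ρ) (hnc : ∃ g h : G, (ρ g).trace.re ≠ (ρ h).trace.re) :
    ∃ β₀ c C : ℝ, 0 < β₀ ∧ 0 < c ∧ c ≤ C ∧ ∀ (L : ℕ) [NeZero L], 3 ≤ L → ∀ β : ℝ, 0 < β → β ≤ β₀ →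
      c * β ^ 4 ≤ latticeConnectedCorr ρ β L (plaquetteObs ρ 0 1 2) (plaquetteObs ρ 0 1 2) 1 ∧
        latticeConnectedCorr ρ β L (plaquetteObs ρ 0 1 2) (plaquetteObs ρ 0 1 2) 1 ≤ C * β ^ 4 := by
  set m₀ : ℝ := ∫ h, (ρ h).trace.re ∂haarProbability G with hm₀
  set φ : G → ℝ := fun g => (ρ g).trace.re - m₀ with hφ
  set J : ℝ := ((haarConv φ)^[5] φ) 1 with hJ
  -- `J > 0`
  have hφc : Continuous φ := (continuous_trace_re ρ hρ).sub continuous_const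
  have hφs : ∀ g, φ g⁻¹ = φ g := fun g => by
    simp only [hφ, Literature.RepresentationTheory.CompactGroups.CompactGroup.re_trace_map_inv ρ hρ]
  have hφ0 : φ ≠ 0 := by
    obtain ⟨g, h, hgh⟩ := hnc
    intro hz
    have h1 := congrFun hz g
    have h2 := congrFun hz h
    simp only [hφ, Pi.zero_apply, sub_eq_zero] at h1 h2
    exact hgh (h1.trans h2.symm)
  have hJpos : 0 < J := convIter_five_apply_one_pos hφc hφs hφ0
  obtain ⟨K', r, hr, hS⟩ := cov_facing_schwarz ρ hρ
  have hK' : 0 ≤ K' := by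
    have h := hS 3 le_rfl r hr.le le_rfl
    have : (r / r) ^ 5 = 1 := by rw [div_self hr.ne', one_pow]
    rw [this, mul_one] at h
    exact (abs_nonneg _).trans h
  refine ⟨min r (J * r ^ 5 / (2 * K' + 1)), J / 2, 3 * J / 2, by positivity, by positivity, by linarith,
    fun L _ hL β hβ0 hβ => ?_⟩
  have hβr : β ≤ r := hβ.trans (min_le_left _ _)
  have hβJ : β ≤ J * r ^ 5 / (2 * K' + 1) := hβ.trans (min_le_right _ _)
  have hest := hS L hL β hβ0.le hβr
  rw [← latticeConnectedCorr_plaquette_one ρ L β] at hest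
  -- `K' (β/r)⁵ ≤ (J/2) β⁴`
  have hsmall : K' * (β / r) ^ 5 ≤ J / 2 * β ^ 4 := by
    rw [div_pow, mul_div_assoc']
    rw [div_le_iff₀ (by positivity)]
    have h1 : β * (2 * K' + 1) ≤ J * r ^ 5 := by rwa [le_div_iff₀ (by positivity)] at hβJ
    have hβ4 : 0 ≤ β ^ 4 := by positivity
    nlinarith [mul_le_mul_of_nonneg_left h1 hβ4, hβ0.le, pow_nonneg hβ0.le 5]
  obtain ⟨hlo, hhi⟩ := abs_le.1 (hest.trans hsmall)
  constructor <;> nlinarith [hlo, hhi]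

end Summit.QuantumFields.YangMills.Cruxes.IR.SCFloor

end
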